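import Summits.KontsevichZagierPeriods.KontsevichZagierPeriods.Theses.HardSphereVirial
import Summits.KontsevichZagierPeriods.KontsevichZagierPeriods.Theorems.InverseLandauTateLiftingIsotropySpace
import Summits.KontsevichZagierPeriods.KontsevichZagierPeriods.Theorems.SymplecticScissorsAssembly
import Summits.KontsevichZagierPeriods.KontsevichZagierPeriods.Theorems.HermiteRigidityReductionRigidityFrame
import Summits.KontsevichZagierPeriods.KontsevichZagierPeriods.Theorems.FurushoPentagonSectorToKernelOfLeaves

/-!
Crux-strategist record (cstrat stmt-KontsevichZagierPeriods-10457): WHERE THE RESTATED VERDICT OF ROUTE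
HardSphereVirial REALLY LIVES, kernel-checked.

* `closes_without_h5` — with `IsotropyFactorisation3` (10457) a landed theorem and `Assembly` (3822) landed,
  the deciding theorem needs only `UnitDistanceKernel`, `StarFourSphere`, `StarFourDisc`.
* `unitDistanceKernel_of_summit` — `UnitDistanceKernel` (14472) is a CONSEQUENCE of the summit (S ⟹ VolumeForm ⟹ it),
  hence, together with `closes_without_h5`, it is the summit MODULO the two star relators: the at-least-summit
  binder of this route is 14472, not 10457.
-/

namespace Summit.KontsevichZagierPeriods.KontsevichZagierPeriods.Theses.HardSphereVirial

open Literature.NumberTheory.Transcendental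

/-- The route's deciding theorem with the engine binder discharged by the landed space engine. -/
theorem closes_without_h5 (hK : UnitDistanceKernel) (h2 : StarFourSphere) (h4 : StarFourDisc) :
    KontsevichZagierPeriods :=
  closes hK h2 h4 Summit.KontsevichZagierPeriods.InverseLandau.tateLifting_isotropySpaceMove
    Summit.KontsevichZagierPeriods.VolumeFormAssembly.hardSphereVirial_assembly_proof

/-- The summit implies the kernel crux (S ⟹ VolumeForm ⟹ differences of equal volumes lie in relations ≤ R). -/
theorem unitDistanceKernel_of_summit (h : KontsevichZagierPeriods) : UnitDistanceKernel := by
  intro R hR _ _ _ N r r' hr hr' hv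
  have hV : VolumeForm :=
    Summit.KontsevichZagierPeriods.PlanarAreas.Negative.volumeForm_of_summit h
  exact hR (hV r r' hr hr' hv)

/-- Hence, over the tree: `UnitDistanceKernel ∧ StarFourSphere ∧ StarFourDisc ↔ KontsevichZagierPeriods` as soon as the
two star chains are consequences of the summit (they are instances of Conjecture 1 with certified values); recorded
here in the direction that needs no value theorem. -/
theorem summit_iff_udk_of_stars (h2 : StarFourSphere) (h4 : StarFourDisc) :
    KontsevichZagierPeriods ↔ UnitDistanceKernel :=
  ⟨unitDistanceKernel_of_summit, fun hK => closes_without_h5 hK h2 h4⟩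

/-- Census §4.2, kernel-checked: the frame's filed redirect (CubeResolution 17978 ∧ AyoubEffectiveCubeKernel 18116, here in the
`cubicalSpan` dress of the landed two-leaf theorem) gives `UnitDistanceKernel` in two lines — THROUGH the summit
(`SectorToKernel.kontsevichZagierPeriods_of_cubeResolution_of_ayoubKernel`, landed), hence a `trivial_seam` for BC2 (b). -/
theorem unitDistanceKernel_of_leaves
    (h1 : ∀ (N : ℕ) (u : KZ.IntegralRep N), ∃ c : KZ.FormalRep,
      c ∈ Summit.KontsevichZagierPeriods.FurushoPentagon.ReducedPeriodRing.cubicalSpan ∧ KZ.of u - c ∈ KZ.relations)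
    (h6 : ∀ F ∈ AyoubRel.Oan (Rat.castHom ℂ), AyoubRel.intC F = 0 →
      F ∈ AyoubRel.kSpan (Rat.castHom ℂ)
        {x : AyoubRel.CSeries | ∃ G ∈ AyoubRel.Oan (Rat.castHom ℂ), ∃ i : ℕ, x = AyoubRel.relAC i G}) :
    UnitDistanceKernel :=
  unitDistanceKernel_of_summit
    (Summit.KontsevichZagierPeriods.FurushoPentagon.SectorToKernel.kontsevichZagierPeriods_of_cubeResolution_of_ayoubKernel
      h1 h6)

end Summit.KontsevichZagierPeriods.KontsevichZagierPeriods.Theses.HardSphereVirial
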